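import Literature.AlgebraicGeometry.Motives.FlatFamilyDegreeFormsDictionary
import HarnessLib

/-!
# Presented base changes of an embedded projective family over a RING: the bookkeeping package
# (ring edition of ★ `Motives/FlatFamilyDegreeFormsDictionary.presentedFibre_package`)

Layer `Literature/AlgebraicGeometry/Motives`, namespace `Literature.AlgebraicGeometry.Motives`.  THEOREMS ONLY (no `def`, no instance, no
notation, no named fact, no `sorry`); universe `0`.  Cell `hodgecm-mathlib` (D-0151), F-4 layer 2, II-b (b1) FILE 2A, BLUEPRINT §2 (5) «RING
version of `presentedFibre_package`» (B-p20 (g14) blueprint b253c292; author B-p20 (g15)).  Count-neutral capital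
(`--supports stmt-HodgeConjecture-24835`); HC_CM is proved only modulo the 7 printed citations until rung 0 closes, and nothing here bears on it.

## The source, as printed

[Hartshorne1977] II Thm. 3.3 (p. 87) (fibred products exist; pasting of cartesian squares), II §4 (p. 103) (`𝐏ⁿ_Y := 𝐏ⁿ_ℤ ×_{Spec ℤ} Y`),
II Prop. 5.12 (c) (p. 117) («`𝒪_X(n) ≅ g^*(𝒪_Y(n))` for `g : X = Proj T → Y = Proj S` induced by a surjective graded map»), II Ex. 3.10 (fibres);
[GortzWedhorn2020] Prop. 4.20 (p. 104) (base change of closed subschemes) and Section (4.12) (p. 113) (`𝐏ⁿ_S` and base change).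
The statement below is the verbatim ring edition of ★ `presentedFibre_package` (there `K` a field): its proof — pasting of cartesian squares
and transport of structure along an EQUALITY of structure maps — never used that `K` is a field.

## Setting

`T` a scheme, `i : Z ⟶ 𝐏(ι; T) = T × 𝐏ⁿ_ℤ` an embedded family (`n = Nat.card ι`, ★ `Morphisms/ProjectiveMorphism`), `x : Spec A → T` a point
with values in a RING `A`, `𝐏ⁿ_A = ProjCech.PP A n` (★ `Morphisms/CechH1Projective`) with structure map `toSpec A n : 𝐏ⁿ_A → Spec A`, Serre
twists `twistMod ι 𝒪 d` and monomial sections `μ_w` (★ `Modules/SerreTwistMod`, ★ `Modules/SerreTwistMonomialSections`).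

## Statement

* `presentedFibre_package_ring`: given `kP : 𝐏ⁿ_A → 𝐏(ι; T)` CARTESIAN over `x` with second component `kP ≫ pr₂ = PM` (`PM : 𝐏ⁿ_A → 𝐏ⁿ_ℤ` a
  binder — in practice `Proj (ℤ[x] → A[x])`), a cartesian square `X₀ = Z ×_T Spec A` (`H`) PRESENTED as `ιA : X₀ → 𝐏ⁿ_A` over `A` (`hf₀`) with
  `kX ≫ i ≫ pr₂ = ιA ≫ PM` (`w`), and monomial-preserving transports `twistMod (𝟙 ≫ PM) 𝒪 d ≅ twistMod 𝟙 𝒪 d` on `𝐏ⁿ_A`,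
  `twistMod (ιA ≫ PM) 𝒪 d ≅ twistMod ιA 𝒪 d` on `X₀`: THEN (1) the square `X₀ → Z` over `kP` is cartesian, (2) `twistMod (kP ≫ pr₂) 𝒪 d ≅ twistMod 𝟙 𝒪 d`
  and (3) `twistMod (kX ≫ i ≫ pr₂) 𝒪_{X₀} d ≅ twistMod ιA 𝒪_{X₀} d`, both taking monomial sections to monomial sections.

## References
* [Hartshorne1977] R. Hartshorne, *Algebraic Geometry*, GTM 52 (1977), II Thm. 3.3 (p. 87), II §4 (p. 103), II Prop. 5.12 (c) (p. 117), II Ex. 3.10.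
* [GortzWedhorn2020] U. Görtz, T. Wedhorn, *Algebraic Geometry I*, 2nd ed. (2020), Prop. 4.20 (p. 104), Section (4.12) (p. 113).
-/

noncomputable section

-- `TopCat.Presheaf`/`Scheme.Modules` are not reducible (as in Mathlib's `AlgebraicGeometry/Modules/Sheaf.lean`).
set_option backward.isDefEq.respectTransparency false

open CategoryTheory CategoryTheory.Limits AlgebraicGeometry TopologicalSpace Opposite
open Literature.AlgebraicGeometry.Morphisms Literature.AlgebraicGeometry.Morphisms.ProjCech
open Literature.AlgebraicGeometry.Modules Literature.AlgebraicGeometry.Modules.SerreTwist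

namespace Literature.AlgebraicGeometry.Motives

section PresentedFibreRing

variable {ι : Type} {T Z : Scheme.{0}} (i : Z ⟶ Morphisms.projectiveSpace ι T) (d : ℕ)

/-- **Bookkeeping for one presented base change over a ring** (ring edition of ★ `presentedFibre_package`, same letters with the field `K`
replaced by a ring `A`).  Given an `A`-point `x : Spec A → T`, a morphism `kP : 𝐏ⁿ_A → 𝐏(ι; T)` CARTESIAN over `x` with second component
`kP ≫ pr₂ = PM` (`PM : 𝐏ⁿ_A → 𝐏ⁿ_ℤ`, a binder — in practice `Proj (ℤ[x] → A[x])`), a cartesian square `X₀ = Z ×_T Spec A` (`H`) PRESENTED as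
`ιA : X₀ → 𝐏ⁿ_A` over `A` (`hf₀`) with `kX ≫ i ≫ pr₂ = ιA ≫ PM` (`w`), and transports `twistMod (𝟙 ≫ PM) 𝒪 d ≅ twistMod 𝟙 𝒪 d` on `𝐏ⁿ_A`,
`twistMod (ιA ≫ PM) 𝒪 d ≅ twistMod ιA 𝒪 d` on `X₀` taking monomials to monomials: THEN (1) the square `X₀ → Z` over `kP` is cartesian (the outer
square over `T` is — pasting, `IsPullback.of_bot`; commutativity is checked on the two components of `𝐏(ι; T) = T × 𝐏ⁿ_ℤ`), and composing with the
identity transfers along `kP ≫ pr₂ = 𝟙 ≫ PM`, `kX ≫ i ≫ pr₂ = ιA ≫ PM` (★ `exists_twistMod_iso_of_structureMap_eq`) gives the transports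
(2) `twistMod (kP ≫ pr₂) 𝒪 d ≅ twistMod 𝟙 𝒪 d` and (3) `twistMod (kX ≫ i ≫ pr₂) 𝒪_{X₀} d ≅ twistMod ιA 𝒪_{X₀} d`, monomials to monomials.
[cite: Hartshorne1977, II Thm. 3.3 (p. 87) and II Prop. 5.12 (c) (p. 117)] [cite: GortzWedhorn2020, Prop. 4.20 (p. 104)] -/
theorem presentedFibre_package_ring {A : Type} [CommRing A] {x : Spec (CommRingCat.of A) ⟶ T}
    {PM : PP A (Nat.card ι) ⟶ Morphisms.projectiveSpaceInt ι} {kP : PP A (Nat.card ι) ⟶ Morphisms.projectiveSpace ι T}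
    (HC : IsPullback kP (toSpec A (Nat.card ι)) (Morphisms.projectiveSpaceFst ι T) x)
    (hkP : kP ≫ pullback.snd (terminal.from T) (terminal.from (Morphisms.projectiveSpaceInt ι)) = PM)
    (χ : twistMod (𝟙 (PP A (Nat.card ι)) ≫ PM) (unitModule (PP A (Nat.card ι))) d ≅
      twistMod (𝟙 (PP A (Nat.card ι))) (unitModule (PP A (Nat.card ι))) d)
    (hχ : ∀ wd : Fin d → Fin (Nat.card ι + 1),
      χ.hom.app ⊤ (monomialSection (𝟙 (PP A (Nat.card ι)) ≫ PM) d wd) = monomialSection (𝟙 (PP A (Nat.card ι))) d wd)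
    {X₀ : Scheme.{0}} {kX : X₀ ⟶ Z} {f₀ : X₀ ⟶ Spec (CommRingCat.of A)}
    (H : IsPullback kX f₀ (i ≫ Morphisms.projectiveSpaceFst ι T) x)
    {ιA : X₀ ⟶ PP A (Nat.card ι)} (hf₀ : ιA ≫ toSpec A (Nat.card ι) = f₀)
    (w : kX ≫ i ≫ pullback.snd (terminal.from T) (terminal.from (Morphisms.projectiveSpaceInt ι)) = ιA ≫ PM)
    (φ : twistMod (ιA ≫ PM) (unitModule X₀) d ≅ twistMod ιA (unitModule X₀) d)
    (hφ : ∀ wd : Fin d → Fin (Nat.card ι + 1), φ.hom.app ⊤ (monomialSection (ιA ≫ PM) d wd) = monomialSection ιA d wd) :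
    IsPullback ιA kX kP i ∧
    (∃ Φ : twistMod (kP ≫ pullback.snd (terminal.from T) (terminal.from (Morphisms.projectiveSpaceInt ι)))
        (unitModule (PP A (Nat.card ι))) d ≅ twistMod (𝟙 (PP A (Nat.card ι))) (unitModule (PP A (Nat.card ι))) d,
      ∀ wd : Fin d → Fin (Nat.card ι + 1),
        Φ.hom.app ⊤ (monomialSection (kP ≫ pullback.snd (terminal.from T) (terminal.from (Morphisms.projectiveSpaceInt ι))) d wd) =
          monomialSection (𝟙 (PP A (Nat.card ι))) d wd) ∧
    ∃ Φ₀ : twistMod (kX ≫ i ≫ pullback.snd (terminal.from T) (terminal.from (Morphisms.projectiveSpaceInt ι))) (unitModule X₀) d ≅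
        twistMod ιA (unitModule X₀) d,
      ∀ wd : Fin d → Fin (Nat.card ι + 1),
        Φ₀.hom.app ⊤ (monomialSection (kX ≫ i ≫ pullback.snd (terminal.from T) (terminal.from (Morphisms.projectiveSpaceInt ι))) d wd) =
          monomialSection ιA d wd := by
  -- the square `X₀ → Z` over `kP : 𝐏ⁿ_A → 𝐏(ι; T)` commutes (componentwise on `T × 𝐏ⁿ_ℤ`), hence is cartesian (the outer square over `T` is)
  have HCw : kP ≫ pullback.fst (terminal.from T) (terminal.from (Morphisms.projectiveSpaceInt ι)) = toSpec A (Nat.card ι) ≫ x :=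
    HC.w
  have hsq : kX ≫ i = ιA ≫ kP := by
    apply pullback.hom_ext
    · rw [Category.assoc, Category.assoc, HCw, ← Category.assoc ιA (toSpec A (Nat.card ι)) x, hf₀]
      exact H.w
    · rw [Category.assoc, Category.assoc, hkP, w]
  -- the identity transfers
  obtain ⟨χ₂, hχ₂⟩ := exists_twistMod_iso_of_structureMap_eq
    (show kP ≫ pullback.snd (terminal.from T) (terminal.from (Morphisms.projectiveSpaceInt ι)) = 𝟙 (PP A (Nat.card ι)) ≫ PM by
      rw [hkP, Category.id_comp]) d
  obtain ⟨φ₂, hφ₂⟩ := exists_twistMod_iso_of_structureMap_eq w d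
  refine ⟨(IsPullback.of_bot (by rw [hf₀]; exact H) hsq HC).flip, ⟨χ₂ ≪≫ χ, fun wd => ?_⟩, ⟨φ₂ ≪≫ φ, fun wd => ?_⟩⟩
  · change χ.hom.app ⊤ (χ₂.hom.app ⊤ (monomialSection _ d wd)) = _
    rw [hχ₂, hχ]
  · change φ.hom.app ⊤ (φ₂.hom.app ⊤ (monomialSection _ d wd)) = _
    rw [hφ₂, hφ]

/-- **The cartesian square alone** (conclusion (1) of `presentedFibre_package_ring`, with no twist data): for an `A`-point `x : Spec A → T`,
`kP : 𝐏ⁿ_A → 𝐏(ι; T)` cartesian over `x`, and a cartesian square `X₀ = Z ×_T Spec A` presented as `ιA : X₀ → 𝐏ⁿ_A` over `A` with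
`kX ≫ i ≫ pr₂ = ιA ≫ (kP ≫ pr₂)`, the square `ιA, kX` over `kP, i` is cartesian — so `X₀ ↪ 𝐏ⁿ_A` is the base change of `Z ↪ 𝐏(ι; T)` along `kP`
and `𝓘_{X₀} = 𝓘_Z · 𝒪_{𝐏ⁿ_A}` (★ `ker_eq_comap_ker_of_isPullback`). [cite: Hartshorne1977, II Thm. 3.3 (p. 87)]
[cite: GortzWedhorn2020, Prop. 4.20 (p. 104)] -/
theorem isPullback_of_presentedFibre_ring {A : Type} [CommRing A] {x : Spec (CommRingCat.of A) ⟶ T}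
    {kP : PP A (Nat.card ι) ⟶ Morphisms.projectiveSpace ι T}
    (HC : IsPullback kP (toSpec A (Nat.card ι)) (Morphisms.projectiveSpaceFst ι T) x)
    {X₀ : Scheme.{0}} {kX : X₀ ⟶ Z} {f₀ : X₀ ⟶ Spec (CommRingCat.of A)}
    (H : IsPullback kX f₀ (i ≫ Morphisms.projectiveSpaceFst ι T) x)
    {ιA : X₀ ⟶ PP A (Nat.card ι)} (hf₀ : ιA ≫ toSpec A (Nat.card ι) = f₀)
    (w : kX ≫ i ≫ pullback.snd (terminal.from T) (terminal.from (Morphisms.projectiveSpaceInt ι)) =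
      ιA ≫ kP ≫ pullback.snd (terminal.from T) (terminal.from (Morphisms.projectiveSpaceInt ι))) :
    IsPullback ιA kX kP i := by
  have HCw : kP ≫ pullback.fst (terminal.from T) (terminal.from (Morphisms.projectiveSpaceInt ι)) = toSpec A (Nat.card ι) ≫ x :=
    HC.w
  have hsq : kX ≫ i = ιA ≫ kP := by
    apply pullback.hom_ext
    · rw [Category.assoc, Category.assoc, HCw, ← Category.assoc ιA (toSpec A (Nat.card ι)) x, hf₀]
      exact H.w
    · rw [Category.assoc, Category.assoc, w]
  exact (IsPullback.of_bot (by rw [hf₀]; exact H) hsq HC).flip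

/-- **Kernel form**: in the situation of `isPullback_of_presentedFibre_ring` with `i` a closed immersion, the ideal of the presented base
change `ιA : X₀ ↪ 𝐏ⁿ_A` is the pulled-back ideal of `Z ↪ 𝐏(ι; T)` along `kP` (`IdealSheafData.comap`).
[cite: GortzWedhorn2020, Prop. 4.20 (p. 104)] [cite: Hartshorne1977, II Ex. 3.11 (a)] -/
theorem ker_presentedFibre_ring_eq_comap [IsClosedImmersion i] {A : Type} [CommRing A] {x : Spec (CommRingCat.of A) ⟶ T}
    {kP : PP A (Nat.card ι) ⟶ Morphisms.projectiveSpace ι T}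
    (HC : IsPullback kP (toSpec A (Nat.card ι)) (Morphisms.projectiveSpaceFst ι T) x)
    {X₀ : Scheme.{0}} {kX : X₀ ⟶ Z} {f₀ : X₀ ⟶ Spec (CommRingCat.of A)}
    (H : IsPullback kX f₀ (i ≫ Morphisms.projectiveSpaceFst ι T) x)
    {ιA : X₀ ⟶ PP A (Nat.card ι)} [IsClosedImmersion ιA] (hf₀ : ιA ≫ toSpec A (Nat.card ι) = f₀)
    (w : kX ≫ i ≫ pullback.snd (terminal.from T) (terminal.from (Morphisms.projectiveSpaceInt ι)) =
      ιA ≫ kP ≫ pullback.snd (terminal.from T) (terminal.from (Morphisms.projectiveSpaceInt ι))) :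
    ιA.ker = i.ker.comap kP :=
  ker_eq_comap_ker_of_isPullback (isPullback_of_presentedFibre_ring i HC H hf₀ w)

end PresentedFibreRing

end Literature.AlgebraicGeometry.Motives

end
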